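import Literature.Probability.RandomPlanarGeometry.HexSAWTriangle
import Mathlib.Analysis.SpecificLimits.Basic
import HarnessLib

/-!
# Glazman–Manolescu, Proposition 1.1: bridges of the hexagonal lattice decay, `B_T(x_c) → 0`

Topic `Literature/Probability/RandomPlanarGeometry`; second support file for the discharge of
`Literature.Probability.RandomPlanarGeometry.SAW.YangBaxter.GlazmanManolescu2019_prop11_limit`.
Source: A. Glazman, I. Manolescu, *Self-avoiding walk on `ℤ²` with Yang–Baxter weights:
universality of critical fugacity and 2-point function*, Ann. Inst. Henri Poincaré Probab. Stat. 56
(2020), arXiv:1708.00395, **Proposition 1.1** and its proof, §4.1 (pp. 10–11): "the partition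
function of self-avoiding bridges on the hexagonal lattice vanishes at infinity: `B_T(π/3) → 0`"
(first proved, by a different, probabilistic argument, in [BBDDG] = Beaton, Bousquet-Mélou,
de Gier, Duminil-Copin, Guttmann, CMP 326 (2014), Thm 10). We work in the coordinate model `HV` of
the honeycomb lattice (see `HexSAWTriangle.lean` for the conventions) and prove the printed
argument:

> "For `L > 0` and `0 ≤ K ≤ 2L`, write `Δ^Δ_{L,K}` for the partition function of walks in `T_L`,
> starting at `0` and ending on the top boundary, `K` units from the left boundary. …
> Divide the right half-plane using the lines `arg(z) = ±π/6` into three `π/3`-angles. For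
> `0 ≤ K₃ ≤ 2K₂ ≤ 4K₁ ≤ 8L` and walks `γ⁽¹⁾, γ⁽²⁾, γ⁽³⁾` contributing to `Δ^Δ_{L,K₁}`, `Δ^Δ_{K₁,K₂}`
> and `Δ^Δ_{K₂,K₃}`, respectively, obtain a walk contributing to `G(-L, K₃)` by concatenating the
> translate of `γ₁` …, the rotation by `π/3` of the translate of `γ⁽²⁾` …, and the rotation by
> `2π/3` of the translate of `γ⁽³⁾` …. By summing over all values of `K₁, K₂, K₃` we find
> `Σ Δ^Δ_{L,K₁} Σ Δ^Δ_{K₁,K₂} Σ Δ^Δ_{K₂,K₃} ≤ Σ_{k=L}^{9L} G(0,k)` … `≥ (1/8)(D^Δ_{4L})³` …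
> since `D^Δ_T` is decreasing, this implies `D^Δ_T → 0`. The conclusions translate to `B_T` using
> (4.1)."

Only the limit `B_T → 0` is formalised (it is all that the named fact, Theorem 1 and Theorem 2
use); the quantitative series `Σ_T (B_T)³/T < ∞` of eq. (3) would follow from the same inequality
`key_ineq` by the dyadic bookkeeping of p. 11, which we do not reproduce.

## Contents (namespace `Literature.Probability.RandomPlanarGeometry.SAW.HV`)

* `rot60` — the rotation by `π/3` about the hexagon centre `pos = (0, 0)`:
  `(x₀, x₁, b) ↦ (-x₁ - 1, x₀ + x₁ + b, ¬b)`, a graph automorphism of `ℍ` ("the invariance under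
  rotation by `π/3`", p. 4); `sig2 L K`, `sig3 L K` — the placements (translate, rotate by `π/3`
  resp. `2π/3` about the corner `(-L, 0)` of `T_L`) of the second and third pieces.
* `leftWalks L` (the walks of `T_L` from `a` to its left side, `Σ_K Δ^Δ_{L,K} = triDl L`),
  `exitHt` (the `K` of the exit), `dom L` (the triples `(γ¹, γ², γ³)`), `glue L` (the concatenated
  walk: an arc of the half-plane from `a` ending on the boundary line `L + K₃ + 1` columns to the
  left of `a`), `glue_mem` (it is a self-avoiding walk of `S_{T',L''}` to `α`, for
  `T' ≥ 8L + 1`, `L'' ≥ 9L + 1`: the three pieces live in the three disjoint sectors at the corner),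
  `decode_glue`/`glue_injOn` (the concatenation is injective), `mwLen_glue` (lengths add).
* **`key_ineq`**: `triDl (4L)³ ≤ Σ_{arcs of S_{T',L''} exiting in columns [-9L-1, -L-1]} x_c^ℓ`
  (the displayed chain of inequalities, with `D^Δ = 2 triDl` and the monotonicity of `triDl`);
* **`triDl_pow_three_le`**: `(m+1) · triDl(4·10^m)³ ≤ 1/cos(3π/8)` (sum `key_ineq` over the
  disjoint blocks `L = 10^i`, `i ≤ m`, and bound by `A_{T',L''} ≤ 1/c_α`, Lemma 2);
* **`tendsto_triDl`** (`triDl L → 0`), **`stripB_eventually_le`** (for every `ε > 0`,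
  `B_{T,L'}(x_c) ≤ ε` for all large `T` and all `L'`) and **`tendsto_stripBlim`**: Duminil-Copin–
  Smirnov's `B_T(x_c) = sup_L B_{T,L}(x_c)` tends to `0` — Proposition 1.1 / [BBDDG, Thm 10] for the
  hexagonal lattice. The transfer to the Yang–Baxter encoding at `Θ ≡ π/3` is done separately.
-/

noncomputable section

open Finset Filter Topology

namespace Literature.Probability.RandomPlanarGeometry.SAW

namespace HV

open Real

/-! ### The rotation by `π/3` and the placements of the three pieces -/

/-- **Rotation by `π/3`** about the hexagon centre at `pos = (0, 0)` (the centre just left of `a`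
on the boundary line): in coordinates `(x₀, x₁, b) ↦ (-x₁ - 1, x₀ + x₁ + b, ¬b)` (the frame vector
`e₀` goes to `e₁ = ω e₀`, `e₁` to `e₁ - e₀`). A graph automorphism of the honeycomb lattice.
[cite: GlazmanManolescu2019, §1 ("the invariance under rotation by π/3") and §4.1] -/
def rot60 : hvGraph ≃g hvGraph where
  toFun v := (-v.2.1 - 1, v.1 + v.2.1 + bit v, !v.2.2)
  invFun v := (v.1 + v.2.1 + bit v, -v.1 - 1, !v.2.2)
  left_inv v := by
    obtain ⟨a, b, c⟩ := v
    refine Prod.ext ?_ (Prod.ext ?_ ?_)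
    · cases c <;> simp only [bit_true, bit_false, Bool.not_true, Bool.not_false] <;> omega
    · dsimp only; omega
    · cases c <;> rfl
  right_inv v := by
    obtain ⟨a, b, c⟩ := v
    refine Prod.ext ?_ (Prod.ext ?_ ?_)
    · dsimp only; omega
    · cases c <;> simp only [bit_true, bit_false, Bool.not_true, Bool.not_false] <;> omega
    · cases c <;> rfl
  map_rel_iff' := by
    intro u v
    obtain ⟨a, b, c⟩ := u
    obtain ⟨a', b', c'⟩ := v
    cases c <;> cases c' <;> simp [hvGraph_adj, AdjRel, bit] <;> omega

/-- `rot60` in coordinates. [folklore] -/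
@[simp] theorem rot60_apply (v : HV) : rot60 v = (-v.2.1 - 1, v.1 + v.2.1 + bit v, !v.2.2) := rfl

/-- **Placement of the second piece**: translate the corner `(-K, 0)` of `T_K` to the corner
`(-L, 0)` of `T_L`, then rotate by `π/3` about it:
`(x₀, x₁, b) ↦ (-x₁ - 1 - L, x₀ + x₁ + b + K, ¬b)`. [cite: GlazmanManolescu2019, §4.1 ("the
rotation by π/3 of the translate of γ⁽²⁾")] -/
def sig2 (L K : ℤ) : hvGraph ≃g hvGraph := ((shift K 0).trans rot60).trans (shift (-L) 0)

/-- **Placement of the third piece**: translate, then rotate by `2π/3` about the corner: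
`(x₀, x₁, b) ↦ (-x₀ - x₁ - b - K - 1 - L, x₀ + K, b)`. [cite: GlazmanManolescu2019, §4.1 ("the
rotation by 2π/3 of the translate of γ⁽³⁾")] -/
def sig3 (L K : ℤ) : hvGraph ≃g hvGraph :=
  ((shift K 0).trans (rot60.trans rot60)).trans (shift (-L) 0)

/-- `sig2` in coordinates. [folklore] -/
@[simp] theorem sig2_apply (L K : ℤ) (v : HV) :
    sig2 L K v = (-v.2.1 - 1 - L, v.1 + v.2.1 + bit v + K, !v.2.2) := by
  obtain ⟨a, b, c⟩ := v
  show shift (-L) 0 (rot60 (shift K 0 (a, b, c))) = _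
  cases c
  · simp only [shift_apply, rot60_apply, bit_false, Bool.not_false]
    refine Prod.ext ?_ (Prod.ext ?_ rfl) <;> dsimp only <;> omega
  · simp only [shift_apply, rot60_apply, bit_true, Bool.not_true]
    refine Prod.ext ?_ (Prod.ext ?_ rfl) <;> dsimp only <;> omega

/-- `sig3` in coordinates. [folklore] -/
@[simp] theorem sig3_apply (L K : ℤ) (v : HV) :
    sig3 L K v = (-v.1 - v.2.1 - bit v - K - 1 - L, v.1 + K, v.2.2) := by
  obtain ⟨a, b, c⟩ := v
  show shift (-L) 0 (rot60 (rot60 (shift K 0 (a, b, c)))) = _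
  cases c
  · simp only [shift_apply, rot60_apply, bit_false, bit_true, Bool.not_false, Bool.not_true]
    refine Prod.ext ?_ (Prod.ext ?_ rfl) <;> dsimp only <;> omega
  · simp only [shift_apply, rot60_apply, bit_true, bit_false, Bool.not_true, Bool.not_false]
    refine Prod.ext ?_ (Prod.ext ?_ rfl) <;> dsimp only <;> omega

/-! ### The pieces: walks of `T_L` to its left side -/

/-- **The walks counted by `Σ_K Δ^Δ_{L,K}`**: self-avoiding walks of `T_L` from `a` leaving through
the left side. [cite: GlazmanManolescu2019, §4.1 (Δ^Δ_{L,K})] -/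
def leftWalks (L : ℕ) : Finset (List HV) :=
  (midWalks (triV L)).filter fun P => IsLeftDart L (finalDart P)

/-- **The exit position `K`** ("ending on the top boundary, `K` units from the left boundary"):
the `x₁`-coordinate of the exit vertex. [cite: GlazmanManolescu2019, §4.1 (Δ^Δ_{L,K})] -/
def exitHt (P : List HV) : ℕ := ((finalDart P).1.2.1).toNat

/-- `triDl L` is the sum over `leftWalks L`. [cite: GlazmanManolescu2019, §4.1] -/
theorem triDl_eq (L : ℕ) : triDl L = ∑ P ∈ leftWalks L, hexCriticalFugacity ^ mwLen P := rfl

/-- **Anatomy of a piece**: a walk of `T_L` to the left side is `w, O, …, (-L, K, ·), (-L-1, K, ·)`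
with `K = exitHt ≤ 2L`. [cite: GlazmanManolescu2019, §4.1] -/
theorem mem_leftWalks {L : ℕ} {P : List HV} (hP : P ∈ leftWalks L) :
    ∃ (l : List HV) (hl : l ≠ []), P = wOut :: (l ++ [(-(L : ℤ) - 1, (exitHt P : ℤ), true)]) ∧
      l.getLast hl = (-(L : ℤ), (exitHt P : ℤ), false) ∧ IsMidWalk (triV L) P ∧ exitHt P ≤ 2 * L := by
  rw [leftWalks, mem_filter, mem_midWalks_iff] at hP
  obtain ⟨hW, hleft⟩ := hP
  rcases hW.trivial_or_exists with rfl | ⟨l, u, hl, rfl⟩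
  · exact absurd hleft.2.1 (by simp [finalDart, wOut])
  have hfd := finalDart_cons_append hl u
  rw [hfd] at hleft
  obtain ⟨h1, h2, h3⟩ := hleft
  dsimp only at h1 h2 h3
  obtain ⟨-, -, -, hlV, -, -⟩ := (isMidWalk_cons_append_iff _ hl u).1 hW
  have hv := mem_triV_iff.1 (hlV _ (List.getLast_mem hl))
  have hK : (exitHt (wOut :: (l ++ [u])) : ℤ) = (l.getLast hl).2.1 := by
    rw [exitHt, hfd]; dsimp only; exact Int.toNat_of_nonneg hv.1
  refine ⟨l, hl, ?_, ?_, hW, ?_⟩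
  · rw [hK, ← h1, h3]
  · rw [hK, ← h1, ← h2]
  · have : (exitHt (wOut :: (l ++ [u])) : ℤ) ≤ 2 * L := by
      rw [hK]; simp only [h2, bit] at hv; simp at hv; omega
    exact_mod_cast this

/-! ### The concatenation -/

/-- **The triples `(γ¹, γ², γ³)`**: `γ¹` a walk of `T_L` to its left side exiting at `K₁`, `γ²` a
walk of `T_{K₁}` to its left side exiting at `K₂`, `γ³` a walk of `T_{K₂}` to its left side.
[cite: GlazmanManolescu2019, §4.1] -/
def dom (L : ℕ) : Finset (Σ _ : List HV, Σ _ : List HV, List HV) :=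
  (leftWalks L).sigma fun P₁ => (leftWalks (exitHt P₁)).sigma fun P₂ => leftWalks (exitHt P₂)

/-- The exit vertex of the concatenated walk: below the boundary line, in column `-L - K₃ - 1`.
[cite: GlazmanManolescu2019, §4.1] -/
def glueEnd (L : ℕ) (t : Σ _ : List HV, Σ _ : List HV, List HV) : HV :=
  (-(L : ℤ) - exitHt t.2.2 - 1, -1, true)

/-- **The concatenated walk**: `γ¹`, then `γ²` placed by `sig2 L K₁`, then `γ³` placed by
`sig3 L K₂`, ending on the boundary line at column `-L - K₃ - 1`.
[cite: GlazmanManolescu2019, §4.1 ("obtain a walk contributing to G(-L, K₃) by concatenating …")] -/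
def glue (L : ℕ) (t : Σ _ : List HV, Σ _ : List HV, List HV) : List HV :=
  wOut :: (inner t.1 ++ (inner t.2.1).map (sig2 L (exitHt t.1)) ++
    (inner t.2.2).map (sig3 L (exitHt t.2.1)) ++ [glueEnd L t])

section Glue

variable {L : ℕ}

/-- The second piece lies in the sector `{x₀ ≤ -L-1, x₀ + x₁ + b ≥ -L}`, at heights `≤ 2K`.
[cite: GlazmanManolescu2019, §4.1 ("three π/3-angles")] -/
theorem sig2_region {K : ℕ} {v : HV} (hv : v ∈ triV K) (L : ℕ) :
    (sig2 L K v).1 ≤ -(L : ℤ) - 1 ∧ -(L : ℤ) ≤ (sig2 L K v).1 + (sig2 L K v).2.1 + bit (sig2 L K v) ∧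
      0 ≤ (sig2 L K v).2.1 ∧ (sig2 L K v).2.1 ≤ 2 * K ∧ -(L : ℤ) - 2 * K - 1 ≤ (sig2 L K v).1 := by
  rw [mem_triV_iff] at hv
  obtain ⟨a, b, c⟩ := v
  cases c <;> simp [bit] at hv ⊢ <;> omega

/-- The third piece lies in the sector `{x₀ + x₁ + b ≤ -L-1, x₁ ≥ 0}`, at heights `≤ 2K`.
[cite: GlazmanManolescu2019, §4.1 ("three π/3-angles")] -/
theorem sig3_region {K : ℕ} {v : HV} (hv : v ∈ triV K) (L : ℕ) :
    (sig3 L K v).1 + (sig3 L K v).2.1 + bit (sig3 L K v) ≤ -(L : ℤ) - 1 ∧ 0 ≤ (sig3 L K v).2.1 ∧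
      (sig3 L K v).2.1 ≤ 2 * K ∧ -(L : ℤ) - 2 * K - 1 ≤ (sig3 L K v).1 := by
  rw [mem_triV_iff] at hv
  obtain ⟨a, b, c⟩ := v
  cases c <;> simp [bit] at hv ⊢ <;> omega

/-- The first piece lies in the sector `{x₀ ≥ -L, x₁ ≥ 0}`. [cite: GlazmanManolescu2019, §4.1] -/
theorem triV_region {v : HV} (hv : v ∈ triV L) :
    -(L : ℤ) ≤ v.1 ∧ -(L : ℤ) ≤ v.1 + v.2.1 + bit v ∧ 0 ≤ v.2.1 ∧ v.2.1 ≤ 2 * L ∧ v.1 ≤ L := by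
  rw [mem_triV_iff] at hv
  obtain ⟨a, b, c⟩ := v
  cases c <;> simp [bit] at hv ⊢ <;> omega

/-- The data of a triple of `dom L`, unpacked. [cite: GlazmanManolescu2019, §4.1] -/
structure GlueData (L : ℕ) (t : Σ _ : List HV, Σ _ : List HV, List HV) where
  /-- inner vertices of the three pieces -/
  (l₁ l₂ l₃ : List HV)
  (h₁ : l₁ ≠ []) (h₂ : l₂ ≠ []) (h₃ : l₃ ≠ [])
  (e₁ : t.1 = wOut :: (l₁ ++ [(-(L : ℤ) - 1, (exitHt t.1 : ℤ), true)]))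
  (e₂ : t.2.1 = wOut :: (l₂ ++ [(-(exitHt t.1 : ℤ) - 1, (exitHt t.2.1 : ℤ), true)]))
  (e₃ : t.2.2 = wOut :: (l₃ ++ [(-(exitHt t.2.1 : ℤ) - 1, (exitHt t.2.2 : ℤ), true)]))
  (last₁ : l₁.getLast h₁ = (-(L : ℤ), (exitHt t.1 : ℤ), false))
  (last₂ : l₂.getLast h₂ = (-(exitHt t.1 : ℤ), (exitHt t.2.1 : ℤ), false))
  (last₃ : l₃.getLast h₃ = (-(exitHt t.2.1 : ℤ), (exitHt t.2.2 : ℤ), false))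
  (w₁ : IsMidWalk (triV L) t.1) (w₂ : IsMidWalk (triV (exitHt t.1)) t.2.1)
  (w₃ : IsMidWalk (triV (exitHt t.2.1)) t.2.2)
  (k₁ : exitHt t.1 ≤ 2 * L) (k₂ : exitHt t.2.1 ≤ 2 * exitHt t.1) (k₃ : exitHt t.2.2 ≤ 2 * exitHt t.2.1)

/-- Every triple of `dom L` unpacks. [cite: GlazmanManolescu2019, §4.1] -/
theorem glueData_of_mem {t : Σ _ : List HV, Σ _ : List HV, List HV} (ht : t ∈ dom L) :
    Nonempty (GlueData L t) := by
  rw [dom, mem_sigma, mem_sigma] at ht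
  obtain ⟨h1, h2, h3⟩ := ht
  obtain ⟨l₁, hl₁, e₁, last₁, w₁, k₁⟩ := mem_leftWalks h1
  obtain ⟨l₂, hl₂, e₂, last₂, w₂, k₂⟩ := mem_leftWalks h2
  obtain ⟨l₃, hl₃, e₃, last₃, w₃, k₃⟩ := mem_leftWalks h3
  exact ⟨⟨l₁, l₂, l₃, hl₁, hl₂, hl₃, e₁, e₂, e₃, last₁, last₂, last₃, w₁, w₂, w₃, k₁, k₂, k₃⟩⟩

variable {t : Σ _ : List HV, Σ _ : List HV, List HV}

namespace GlueData

/-- A list with head `O` is `O :: tail`. [folklore] -/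
theorem eq_cons_of_head {l : List HV} (h : l.head? = some hvOrigin) : l = hvOrigin :: l.tail := by
  cases l with
  | nil => simp at h
  | cons a l => simp only [List.head?_cons, Option.some.injEq] at h; rw [h]; rfl

/-- The junction `γ¹ | γ²`: the exit vertex of `γ¹` is the placed origin of `γ²`.
[cite: GlazmanManolescu2019, §4.1] -/
theorem sig2_hvOrigin : sig2 L (exitHt t.1) hvOrigin = (-(L : ℤ) - 1, ((exitHt t.1) : ℤ), true) := by
  rw [sig2_apply]
  simp only [hvOrigin, bit_false]
  refine Prod.ext ?_ (Prod.ext ?_ rfl) <;> dsimp only <;> omega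

/-- The junction `γ² | γ³`: the placed exit vertex of `γ²` is the placed origin of `γ³`.
[cite: GlazmanManolescu2019, §4.1] -/
theorem sig3_hvOrigin :
    sig3 L (exitHt t.2.1) hvOrigin =
      sig2 L (exitHt t.1) (-((exitHt t.1) : ℤ) - 1, ((exitHt t.2.1) : ℤ), true) := by
  rw [sig2_apply, sig3_apply]
  simp only [hvOrigin, bit_false, bit_true]
  refine Prod.ext ?_ (Prod.ext ?_ rfl) <;> dsimp only <;> omega

/-- The placed exit vertex of `γ³` is the end of the concatenation, below the boundary line.
[cite: GlazmanManolescu2019, §4.1] -/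
theorem sig3_exit :
    sig3 L (exitHt t.2.1) (-((exitHt t.2.1) : ℤ) - 1, ((exitHt t.2.2) : ℤ), true) = glueEnd L t := by
  rw [sig3_apply]
  simp only [glueEnd, bit_true]
  refine Prod.ext ?_ (Prod.ext ?_ rfl) <;> dsimp only <;> omega

variable (g : GlueData L t)
include g

/-- The inner list of the concatenation. [cite: GlazmanManolescu2019, §4.1] -/
def M : List HV := g.l₁ ++ (g.l₂.map (sig2 L (exitHt t.1)) ++ g.l₃.map (sig3 L (exitHt t.2.1)))

/-- The concatenation, unfolded. [cite: GlazmanManolescu2019, §4.1] -/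
theorem glue_eq : glue L t = wOut :: (g.M ++ [glueEnd L t]) := by
  have i₁ : inner t.1 = g.l₁ := by rw [g.e₁, inner_cons_append]
  have i₂ : inner t.2.1 = g.l₂ := by rw [g.e₂, inner_cons_append]
  have i₃ : inner t.2.2 = g.l₃ := by rw [g.e₃, inner_cons_append]
  rw [glue, i₁, i₂, i₃]
  simp only [M, List.append_assoc]

/-- `M ≠ []`. [folklore] -/
theorem M_ne_nil : g.M ≠ [] := by
  rw [M]; exact List.append_ne_nil_of_left_ne_nil g.h₁ _

/-- Anatomy of the first piece. [cite: GlazmanManolescu2019, §4.1] -/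
theorem spec₁ : g.l₁.IsChain hvGraph.Adj ∧ g.l₁.head? = some hvOrigin ∧
    hvGraph.Adj (g.l₁.getLast g.h₁) (-(L : ℤ) - 1, ((exitHt t.1) : ℤ), true) ∧ (∀ x ∈ g.l₁, x ∈ triV L) ∧
      g.l₁.Nodup := by
  have h := g.w₁
  rw [g.e₁, isMidWalk_cons_append_iff _ g.h₁] at h
  exact ⟨h.1, h.2.1, h.2.2.1, h.2.2.2.1, h.2.2.2.2.1⟩

/-- Anatomy of the second piece. [cite: GlazmanManolescu2019, §4.1] -/
theorem spec₂ : g.l₂.IsChain hvGraph.Adj ∧ g.l₂.head? = some hvOrigin ∧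
    hvGraph.Adj (g.l₂.getLast g.h₂) (-((exitHt t.1) : ℤ) - 1, ((exitHt t.2.1) : ℤ), true) ∧
      (∀ x ∈ g.l₂, x ∈ triV (exitHt t.1)) ∧ g.l₂.Nodup := by
  have h := g.w₂
  rw [g.e₂, isMidWalk_cons_append_iff _ g.h₂] at h
  exact ⟨h.1, h.2.1, h.2.2.1, h.2.2.2.1, h.2.2.2.2.1⟩

/-- Anatomy of the third piece. [cite: GlazmanManolescu2019, §4.1] -/
theorem spec₃ : g.l₃.IsChain hvGraph.Adj ∧ g.l₃.head? = some hvOrigin ∧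
    hvGraph.Adj (g.l₃.getLast g.h₃) (-((exitHt t.2.1) : ℤ) - 1, ((exitHt t.2.2) : ℤ), true) ∧
      (∀ x ∈ g.l₃, x ∈ triV (exitHt t.2.1)) ∧ g.l₃.Nodup := by
  have h := g.w₃
  rw [g.e₃, isMidWalk_cons_append_iff _ g.h₃] at h
  exact ⟨h.1, h.2.1, h.2.2.1, h.2.2.2.1, h.2.2.2.2.1⟩

/-- The placed last vertex of `γ³` is on the boundary line, at column `-L - K₃ - 1`.
[cite: GlazmanManolescu2019, §4.1 ("the span of the obtained arc is K₃ + L")] -/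
theorem sig3_last : sig3 L (exitHt t.2.1) (g.l₃.getLast g.h₃) = (-(L : ℤ) - (exitHt t.2.2) - 1, 0, false) := by
  rw [g.last₃, sig3_apply]
  simp only [bit_false]
  refine Prod.ext ?_ (Prod.ext ?_ rfl) <;> dsimp only <;> omega

/-- The head of `M` is `O`. [folklore] -/
theorem M_head : g.M.head? = some hvOrigin := by
  rw [M, List.head?_append, g.spec₁.2.1]; rfl

/-- The last vertex of `M`. [folklore] -/
theorem M_getLast : g.M.getLast g.M_ne_nil = (-(L : ℤ) - (exitHt t.2.2) - 1, 0, false) := by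
  have h3 : g.l₃.map (sig3 L (exitHt t.2.1)) ≠ [] := by simp [g.h₃]
  rw [← g.sig3_last]
  simp only [M]
  rw [List.getLast_append_of_ne_nil _ (List.append_ne_nil_of_right_ne_nil _ h3),
    List.getLast_append_of_ne_nil _ h3, List.getLast_map]

/-- `M` is a lattice path. [cite: GlazmanManolescu2019, §4.1 ("concatenating")] -/
theorem M_isChain : g.M.IsChain hvGraph.Adj := by
  obtain ⟨c₁, -, a₁, -, -⟩ := g.spec₁
  obtain ⟨c₂, hd₂, a₂, -, -⟩ := g.spec₂
  obtain ⟨c₃, hd₃, a₃, -, -⟩ := g.spec₃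
  have c₂' : (g.l₂.map (sig2 L (exitHt t.1))).IsChain hvGraph.Adj := by
    rw [List.isChain_map]; exact c₂.imp fun x y h => (sig2 L (exitHt t.1)).map_rel_iff.2 h
  have c₃' : (g.l₃.map (sig3 L (exitHt t.2.1))).IsChain hvGraph.Adj := by
    rw [List.isChain_map]; exact c₃.imp fun x y h => (sig3 L (exitHt t.2.1)).map_rel_iff.2 h
  have h23 : (g.l₂.map (sig2 L (exitHt t.1)) ++ g.l₃.map (sig3 L (exitHt t.2.1))).IsChain hvGraph.Adj := by
    refine List.IsChain.append c₂' c₃' fun x hx y hy => ?_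
    rw [List.getLast?_map, List.getLast?_eq_some_getLast g.h₂, Option.map_some, Option.mem_def,
      Option.some_inj] at hx
    rw [List.head?_map, hd₃, Option.map_some, Option.mem_def, Option.some_inj] at hy
    subst hx; subst hy
    rw [sig3_hvOrigin]
    exact (sig2 L (exitHt t.1)).map_rel_iff.2 a₂
  rw [M]
  refine List.IsChain.append c₁ h23 fun x hx y hy => ?_
  rw [List.getLast?_eq_some_getLast g.h₁, Option.mem_def, Option.some_inj] at hx
  rw [List.head?_append, List.head?_map, hd₂, Option.map_some, Option.some_or, Option.mem_def,
    Option.some_inj] at hy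
  subst hx; subst hy
  rw [sig2_hvOrigin]
  exact a₁

/-- The three pieces are vertex-disjoint and each is self-avoiding: `M` has no repeated vertex.
[cite: GlazmanManolescu2019, §4.1 ("three π/3-angles")] -/
theorem M_nodup : g.M.Nodup := by
  obtain ⟨-, -, -, V₁, n₁⟩ := g.spec₁
  obtain ⟨-, -, -, V₂, n₂⟩ := g.spec₂
  obtain ⟨-, -, -, V₃, n₃⟩ := g.spec₃
  rw [M]
  refine List.Nodup.append n₁ (List.Nodup.append (n₂.map (sig2 L (exitHt t.1)).injective)
    (n₃.map (sig3 L (exitHt t.2.1)).injective) ?_) ?_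
  · intro x hx2 hx3
    rw [List.mem_map] at hx2 hx3
    obtain ⟨y, hy, rfl⟩ := hx2
    obtain ⟨z, hz, hyz⟩ := hx3
    have r2 := sig2_region (V₂ y hy) L
    have r3 := sig3_region (V₃ z hz) L
    rw [hyz] at r3
    omega
  · intro x hx1 hx
    have r1 := triV_region (V₁ x hx1)
    rcases List.mem_append.1 hx with hx2 | hx3
    · rw [List.mem_map] at hx2
      obtain ⟨y, hy, rfl⟩ := hx2
      have r2 := sig2_region (V₂ y hy) L
      omega
    · rw [List.mem_map] at hx3
      obtain ⟨z, hz, rfl⟩ := hx3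
      have r3 := sig3_region (V₃ z hz) L
      omega

/-- The whole concatenation lies in `S_{T',L''}` as soon as `T' ≥ 8L+1` and `L'' ≥ 9L+1`.
[cite: GlazmanManolescu2019, §4.1] -/
theorem M_subset {T' L'' : ℕ} (hT : 8 * L + 1 ≤ T') (hL : 9 * L + 1 ≤ L'') :
    ∀ x ∈ g.M, x ∈ stripV T' L'' := by
  obtain ⟨-, -, -, V₁, -⟩ := g.spec₁
  obtain ⟨-, -, -, V₂, -⟩ := g.spec₂
  obtain ⟨-, -, -, V₃, -⟩ := g.spec₃
  have k₁ := g.k₁; have k₂ := g.k₂; have k₃ := g.k₃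
  intro x hx
  rw [mem_stripV_iff]
  rw [M, List.mem_append, List.mem_append, List.mem_map, List.mem_map] at hx
  rcases hx with hx | ⟨y, hy, rfl⟩ | ⟨z, hz, rfl⟩
  · have r := triV_region (V₁ x hx)
    have hb : bit x ≤ 1 ∧ 0 ≤ bit x := by obtain ⟨a, b, c⟩ := x; cases c <;> simp [bit]
    simp only [lev]; omega
  · have r := sig2_region (V₂ y hy) L
    have hb : bit (sig2 L (exitHt t.1) y) ≤ 1 ∧ 0 ≤ bit (sig2 L (exitHt t.1) y) := by
      generalize sig2 L (exitHt t.1) y = x; obtain ⟨a, b, c⟩ := x; cases c <;> simp [bit]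
    simp only [lev]
    omega
  · have r := sig3_region (V₃ z hz) L
    have hb : bit (sig3 L (exitHt t.2.1) z) ≤ 1 ∧ 0 ≤ bit (sig3 L (exitHt t.2.1) z) := by
      generalize sig3 L (exitHt t.2.1) z = x; obtain ⟨a, b, c⟩ := x; cases c <;> simp [bit]
    simp only [lev]
    omega

/-- Every vertex of `M` is in the upper half-plane. [folklore] -/
theorem M_upper : ∀ x ∈ g.M, 0 ≤ x.2.1 := fun x hx =>
  (mem_stripV_iff.1 (g.M_subset (T' := 8 * L + 1) (L'' := 9 * L + 1) le_rfl le_rfl x hx)).1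

/-- **The concatenation is a self-avoiding walk of `S_{T',L''}` from `a`**, for `T' ≥ 8L+1`,
`L'' ≥ 9L+1`. [cite: GlazmanManolescu2019, §4.1 ("obtain a walk contributing to G(-L,K₃)")] -/
theorem isMidWalk_glue {T' L'' : ℕ} (hT : 8 * L + 1 ≤ T') (hL : 9 * L + 1 ≤ L'') :
    IsMidWalk (stripV T' L'') (glue L t) := by
  rw [g.glue_eq, isMidWalk_cons_append_iff _ g.M_ne_nil]
  refine ⟨g.M_isChain, g.M_head, ?_, g.M_subset hT hL, g.M_nodup, ?_⟩
  · rw [g.M_getLast, ← g.sig3_last, ← sig3_exit]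
    exact (sig3 L (exitHt t.2.1)).map_rel_iff.2 g.spec₃.2.2.1
  · intro h
    rcases prevOf_mem g.M with h' | h'
    · rw [h'] at h
      have := congrArg Prod.fst h
      simp [glueEnd, wOut] at this
      omega
    · rw [← h] at h'
      have := g.M_upper _ h'
      simp [glueEnd] at this

/-- The final half-edge of the concatenation is the `α`-half-edge of column `-L - K₃ - 1`.
[cite: GlazmanManolescu2019, §4.1] -/
theorem finalDart_glue : finalDart (glue L t) = ((-(L : ℤ) - (exitHt t.2.2) - 1, 0, false), glueEnd L t) := by
  rw [g.glue_eq, finalDart_cons_append g.M_ne_nil, g.M_getLast]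

/-- The length of the concatenation is the sum of the lengths. [cite: GlazmanManolescu2019, §4.1] -/
theorem mwLen_glue : mwLen (glue L t) = mwLen t.1 + mwLen t.2.1 + mwLen t.2.2 := by
  rw [g.glue_eq, mwLen_cons_append, g.e₁, g.e₂, g.e₃]
  simp only [mwLen_cons_append, M, List.length_append, List.length_map]
  ring

/-! #### Decoding: the concatenation is injective -/

/-- The inner list of the concatenation is `M`. [folklore] -/
theorem inner_glue : inner (glue L t) = g.M := by
  rw [g.glue_eq, inner_cons_append]

/-- The first piece is the initial run of `M` inside `T_L` (the placed origin of `γ²` that follows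
it lies outside `T_L`). [cite: GlazmanManolescu2019, §4.1] -/
theorem takeWhile_M : g.M.takeWhile (fun x => decide (x ∈ triV L)) = g.l₁ := by
  obtain ⟨-, -, -, V₁, -⟩ := g.spec₁
  rw [M, List.takeWhile_append_of_pos (fun x hx => decide_eq_true (V₁ x hx)),
    eq_cons_of_head g.spec₂.2.1, List.map_cons, List.cons_append,
    List.takeWhile_cons_of_neg, List.append_nil]
  rw [decide_eq_true_eq, sig2_hvOrigin, mem_triV_iff]
  push_cast; omega

/-- After the first piece, `M` continues with the placed second and third pieces. [folklore] -/
theorem drop_M : g.M.drop g.l₁.length = g.l₂.map (sig2 L (exitHt t.1)) ++ g.l₃.map (sig3 L (exitHt t.2.1)) := by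
  rw [M, List.drop_left]

/-- The placed second piece is the initial run of the remainder inside the placed `T_{K₁}` (the
placed origin of `γ³` that follows it is the image of the exit vertex of `γ²`, outside `T_{K₁}`).
[cite: GlazmanManolescu2019, §4.1] -/
theorem takeWhile_rest :
    (g.l₂.map (sig2 L (exitHt t.1)) ++ g.l₃.map (sig3 L (exitHt t.2.1))).takeWhile
        (fun x => decide (x ∈ (triV (exitHt t.1)).image (sig2 L (exitHt t.1)))) = g.l₂.map (sig2 L (exitHt t.1)) := by
  obtain ⟨-, -, -, V₂, -⟩ := g.spec₂
  have hpos : ∀ x ∈ g.l₂.map (sig2 L (exitHt t.1)),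
      decide (x ∈ (triV (exitHt t.1)).image (sig2 L (exitHt t.1))) = true := by
    intro x hx
    rw [List.mem_map] at hx
    obtain ⟨y, hy, rfl⟩ := hx
    exact decide_eq_true (mem_image_of_mem _ (V₂ y hy))
  rw [List.takeWhile_append_of_pos hpos, eq_cons_of_head g.spec₃.2.1, List.map_cons,
    List.takeWhile_cons_of_neg, List.append_nil]
  rw [decide_eq_true_eq, sig3_hvOrigin, mem_image]
  rintro ⟨y, hy, hyx⟩
  have := (sig2 L (exitHt t.1)).injective hyx
  subst this
  rw [mem_triV_iff] at hy
  simp only [bit_true] at hy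
  omega

/-- `K₁` is read off the last vertex of the first piece. [folklore] -/
theorem K₁_eq : (exitHt t.1) = ((g.l₁.getLast g.h₁).2.1).toNat := by
  rw [g.last₁]; simp

/-- `K₂` is read off the last vertex of the second piece. [folklore] -/
theorem K₂_eq : (exitHt t.2.1) = ((g.l₂.getLast g.h₂).2.1).toNat := by
  rw [g.last₂]; simp

/-- `K₃` is read off the last vertex of the third piece. [folklore] -/
theorem K₃_eq : (exitHt t.2.2) = ((g.l₃.getLast g.h₃).2.1).toNat := by
  rw [g.last₃]; simp

end GlueData

/-- The decoding map: recover the three pieces from a concatenation. [folklore] -/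
def decode (L : ℕ) (Q : List HV) : Σ _ : List HV, Σ _ : List HV, List HV :=
  let M := inner Q
  let l₁ := M.takeWhile fun x => decide (x ∈ triV L)
  let K₁ := ((l₁.getLast?.getD hvOrigin).2.1).toNat
  let R := M.drop l₁.length
  let A := R.takeWhile fun x => decide (x ∈ (triV K₁).image (sig2 L K₁))
  let l₂ := A.map (sig2 L K₁).symm
  let K₂ := ((l₂.getLast?.getD hvOrigin).2.1).toNat
  let l₃ := (R.drop A.length).map (sig3 L K₂).symm
  let K₃ := ((l₃.getLast?.getD hvOrigin).2.1).toNat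
  ⟨wOut :: (l₁ ++ [(-(L : ℤ) - 1, (K₁ : ℤ), true)]),
    wOut :: (l₂ ++ [(-(K₁ : ℤ) - 1, (K₂ : ℤ), true)]),
    wOut :: (l₃ ++ [(-(K₂ : ℤ) - 1, (K₃ : ℤ), true)])⟩

/-- Undoing a graph automorphism on a mapped list. [folklore] -/
theorem map_symm_map (φ : hvGraph ≃g hvGraph) (l : List HV) : (l.map φ).map φ.symm = l := by
  rw [List.map_map]
  convert List.map_id l
  funext x
  exact φ.symm_apply_apply x

/-- **Decoding a concatenation gives back the three pieces.** [cite: GlazmanManolescu2019, §4.1] -/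
theorem decode_glue (g : GlueData L t) : decode L (glue L t) = t := by
  have hl₁ : (inner (glue L t)).takeWhile (fun x => decide (x ∈ triV L)) = g.l₁ := by
    rw [g.inner_glue, g.takeWhile_M]
  have hK₁ : ((g.l₁.getLast?.getD hvOrigin).2.1).toNat = (exitHt t.1) := by
    rw [List.getLast?_eq_some_getLast g.h₁, Option.getD_some, ← g.K₁_eq]
  have hR : (inner (glue L t)).drop g.l₁.length = g.l₂.map (sig2 L (exitHt t.1)) ++ g.l₃.map (sig3 L (exitHt t.2.1)) := by
    rw [g.inner_glue, g.drop_M]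
  have hl₂ : ((g.l₂.map (sig2 L (exitHt t.1)) ++ g.l₃.map (sig3 L (exitHt t.2.1))).takeWhile
      (fun x => decide (x ∈ (triV (exitHt t.1)).image (sig2 L (exitHt t.1))))).map (sig2 L (exitHt t.1)).symm = g.l₂ := by
    rw [g.takeWhile_rest, map_symm_map]
  have hK₂ : ((g.l₂.getLast?.getD hvOrigin).2.1).toNat = (exitHt t.2.1) := by
    rw [List.getLast?_eq_some_getLast g.h₂, Option.getD_some, ← g.K₂_eq]
  have hl₃ : ((g.l₂.map (sig2 L (exitHt t.1)) ++ g.l₃.map (sig3 L (exitHt t.2.1))).drop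
      ((g.l₂.map (sig2 L (exitHt t.1)) ++ g.l₃.map (sig3 L (exitHt t.2.1))).takeWhile
        (fun x => decide (x ∈ (triV (exitHt t.1)).image (sig2 L (exitHt t.1))))).length).map (sig3 L (exitHt t.2.1)).symm =
      g.l₃ := by
    rw [g.takeWhile_rest, List.drop_left, map_symm_map]
  have hK₃ : ((g.l₃.getLast?.getD hvOrigin).2.1).toNat = (exitHt t.2.2) := by
    rw [List.getLast?_eq_some_getLast g.h₃, Option.getD_some, ← g.K₃_eq]
  dsimp only [decode]
  rw [hl₁, hK₁, hR, hl₂, hK₂, hl₃, hK₃, ← g.e₁, ← g.e₂, ← g.e₃]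

/-- **The concatenation is injective** on `dom L`. [cite: GlazmanManolescu2019, §4.1] -/
theorem glue_injOn : Set.InjOn (glue L) (dom L : Set (Σ _ : List HV, Σ _ : List HV, List HV)) := by
  intro t ht t' ht' h
  obtain ⟨g⟩ := glueData_of_mem ht
  obtain ⟨g'⟩ := glueData_of_mem ht'
  rw [← decode_glue g, ← decode_glue g', h]

end Glue

/-! ### The key inequality and the decay of `triDl` -/

/-- The arcs of `S_{T',L''}` (walks from `a` to `α ∖ {a}`) exiting in the columns `-9L-1, …, -L-1`
("the sum on the right hand side goes from `L` to `9L` since the span of the obtained arc is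
`K₃ + L`"). [cite: GlazmanManolescu2019, §4.1] -/
def arcsIn (T' L'' L : ℕ) : Finset (List HV) :=
  (midWalks (stripV T' L'')).filter fun Q => IsAlphaDart (finalDart Q) ∧
    -(9 * (L : ℤ)) - 1 ≤ (finalDart Q).1.1 ∧ (finalDart Q).1.1 ≤ -(L : ℤ) - 1

/-- The exit of a left walk of `T_K` is at height `≤ 2K`. [cite: GlazmanManolescu2019, §4.1 ("0 ≤ K ≤ 2L")] -/
theorem exitHt_le {K : ℕ} {P : List HV} (hP : P ∈ leftWalks K) : exitHt P ≤ 2 * K := by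
  obtain ⟨_, _, _, _, _, h⟩ := mem_leftWalks hP
  exact h

/-- **The key inequality** (the displayed chain of §4.1):
`triDl(4L)³ ≤ triDl(L) · triDl(K₁) · triDl(K₂)`-sums `= Σ_{(γ¹,γ²,γ³)} x_c^{ℓ₁+ℓ₂+ℓ₃} ≤ Σ_{arcs exiting in [-9L-1,-L-1]} x_c^ℓ`,
for every `T' ≥ 8L+1`, `L'' ≥ 9L+1`. [cite: GlazmanManolescu2019, §4.1 (proof of Proposition 1.1)] -/
theorem key_ineq (L : ℕ) {T' L'' : ℕ} (hT : 8 * L + 1 ≤ T') (hL : 9 * L + 1 ≤ L'') :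
    triDl (4 * L) ^ 3 ≤ ∑ Q ∈ arcsIn T' L'' L, hexCriticalFugacity ^ mwLen Q := by
  set x := hexCriticalFugacity with hx
  have h0 : 0 ≤ x := hexCriticalFugacity_pos_lt_one.1.le
  have hD0 := triDl_nonneg (4 * L)
  -- the middle term: the sum over triples
  set S := ∑ t ∈ dom L, x ^ (mwLen t.1 + mwLen t.2.1 + mwLen t.2.2) with hS
  have hlow : triDl (4 * L) ^ 3 ≤ S := by
    rw [hS, dom, sum_sigma]
    have step3 : ∀ P₁ ∈ leftWalks L, ∀ P₂ ∈ leftWalks (exitHt P₁),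
        x ^ (mwLen P₁ + mwLen P₂) * triDl (4 * L) ≤
          ∑ P₃ ∈ leftWalks (exitHt P₂), x ^ (mwLen P₁ + mwLen P₂ + mwLen P₃) := by
      intro P₁ h₁ P₂ h₂
      have hK : exitHt P₂ ≤ 4 * L := by
        have := exitHt_le h₁; have := exitHt_le h₂; omega
      calc x ^ (mwLen P₁ + mwLen P₂) * triDl (4 * L)
          ≤ x ^ (mwLen P₁ + mwLen P₂) * triDl (exitHt P₂) :=
            mul_le_mul_of_nonneg_left (triDl_antitone hK) (pow_nonneg h0 _)
        _ = ∑ P₃ ∈ leftWalks (exitHt P₂), x ^ (mwLen P₁ + mwLen P₂ + mwLen P₃) := by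
            rw [triDl_eq, ← hx, mul_sum]
            exact sum_congr rfl fun P₃ _ => by rw [← pow_add]
    have step2 : ∀ P₁ ∈ leftWalks L,
        x ^ mwLen P₁ * triDl (4 * L) ^ 2 ≤
          ∑ P₂ ∈ leftWalks (exitHt P₁), x ^ (mwLen P₁ + mwLen P₂) * triDl (4 * L) := by
      intro P₁ h₁
      have hK : exitHt P₁ ≤ 4 * L := by have := exitHt_le h₁; omega
      calc x ^ mwLen P₁ * triDl (4 * L) ^ 2
          ≤ x ^ mwLen P₁ * (triDl (exitHt P₁) * triDl (4 * L)) := by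
            rw [sq]
            exact mul_le_mul_of_nonneg_left (mul_le_mul_of_nonneg_right (triDl_antitone hK) hD0)
              (pow_nonneg h0 _)
        _ = ∑ P₂ ∈ leftWalks (exitHt P₁), x ^ (mwLen P₁ + mwLen P₂) * triDl (4 * L) := by
            rw [triDl_eq, ← hx, sum_mul, mul_sum]
            exact sum_congr rfl fun P₂ _ => by rw [pow_add]; ring
    calc triDl (4 * L) ^ 3 ≤ triDl L * triDl (4 * L) ^ 2 := by
          rw [pow_succ' _ 2]
          exact mul_le_mul_of_nonneg_right (triDl_antitone (by omega)) (pow_nonneg hD0 2)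
      _ = ∑ P₁ ∈ leftWalks L, x ^ mwLen P₁ * triDl (4 * L) ^ 2 := by rw [triDl_eq, ← hx, sum_mul]
      _ ≤ ∑ P₁ ∈ leftWalks L, ∑ P₂ ∈ leftWalks (exitHt P₁),
            x ^ (mwLen P₁ + mwLen P₂) * triDl (4 * L) := sum_le_sum step2
      _ ≤ ∑ P₁ ∈ leftWalks L, ∑ P₂ ∈ leftWalks (exitHt P₁), ∑ P₃ ∈ leftWalks (exitHt P₂),
            x ^ (mwLen P₁ + mwLen P₂ + mwLen P₃) :=
          sum_le_sum fun P₁ h₁ => sum_le_sum fun P₂ h₂ => step3 P₁ h₁ P₂ h₂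
      _ = ∑ P₁ ∈ leftWalks L, ∑ t ∈ (leftWalks (exitHt P₁)).sigma (fun P₂ => leftWalks (exitHt P₂)),
            x ^ (mwLen P₁ + mwLen t.1 + mwLen t.2) :=
          sum_congr rfl fun P₁ _ => by rw [sum_sigma]
  -- the upper bound: inject the triples into the arcs
  have hup : S ≤ ∑ Q ∈ arcsIn T' L'' L, x ^ mwLen Q := by
    rw [hS]
    have key := sum_le_sum_of_injOn_of_nonneg (s := dom L) (t := arcsIn T' L'' L) (glue L)
      glue_injOn ?_ (fun Q => x ^ mwLen Q) (fun _ _ => pow_nonneg h0 _)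
    · refine le_trans (le_of_eq (sum_congr rfl fun t ht => ?_)) key
      obtain ⟨g⟩ := glueData_of_mem ht
      rw [g.mwLen_glue]
    · intro t ht
      obtain ⟨g⟩ := glueData_of_mem ht
      rw [arcsIn, mem_filter, mem_midWalks_iff, g.finalDart_glue]
      refine ⟨g.isMidWalk_glue hT hL, ⟨rfl, rfl, rfl⟩, ?_, ?_⟩
      · have k₁ := g.k₁; have k₂ := g.k₂; have k₃ := g.k₃
        push_cast; omega
      · dsimp only; omega
  exact hlow.trans hup

/-- The blocks of columns `[-9·10^i - 1, -10^i - 1]` are pairwise disjoint. [folklore] -/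
theorem disjoint_arcsIn (T' L'' : ℕ) {i j : ℕ} (hij : i ≠ j) :
    Disjoint (arcsIn T' L'' (10 ^ i)) (arcsIn T' L'' (10 ^ j)) := by
  wlog h : i < j generalizing i j
  · exact (this hij.symm (lt_of_le_of_ne (not_lt.1 h) hij.symm)).symm
  rw [disjoint_left]
  intro Q h1 h2
  rw [arcsIn, mem_filter] at h1 h2
  have hpow : 10 * (10 : ℤ) ^ i ≤ (10 : ℤ) ^ j := by
    rw [← pow_succ']
    exact pow_le_pow_right₀ (by norm_num) h
  have h1' := h1.2.2.1
  have h2' := h2.2.2.2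
  push_cast at h1' h2'
  have : (0 : ℤ) < 10 ^ i := by positivity
  omega

/-- **Summing the key inequality over disjoint blocks**: `(m+1) · triDl(4·10^m)³ ≤ 1/cos(3π/8)`
("Summing the above over `L = 9^k` we find `Σ_k (D^Δ_{4·9^k})³ ≤ 8 Σ_k G(0,k) < ∞`"; we use the
blocks `L = 10^i`, `i ≤ m`, the monotonicity of `triDl`, and `A_{T',L''} ≤ 1/c_α` from Lemma 2).
[cite: GlazmanManolescu2019, §4.1 (proof of Proposition 1.1)] -/
theorem triDl_pow_three_le (m : ℕ) :
    (m + 1 : ℝ) * triDl (4 * 10 ^ m) ^ 3 ≤ (Real.cos (3 * Real.pi / 8))⁻¹ := by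
  set T' := 8 * 10 ^ m + 1 with hT'
  set L'' := 9 * 10 ^ m + 1 with hL''
  have h0 : 0 ≤ hexCriticalFugacity := hexCriticalFugacity_pos_lt_one.1.le
  have hblock : ∀ i ∈ range (m + 1), triDl (4 * 10 ^ m) ^ 3 ≤
      ∑ Q ∈ arcsIn T' L'' (10 ^ i), hexCriticalFugacity ^ mwLen Q := by
    intro i hi
    rw [mem_range] at hi
    have hpow : 10 ^ i ≤ 10 ^ m := Nat.pow_le_pow_right (by norm_num) (by omega)
    calc triDl (4 * 10 ^ m) ^ 3 ≤ triDl (4 * 10 ^ i) ^ 3 :=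
          pow_le_pow_left₀ (triDl_nonneg _) (triDl_antitone (by omega)) 3
      _ ≤ _ := key_ineq (10 ^ i) (by rw [hT']; omega) (by rw [hL'']; omega)
  calc (m + 1 : ℝ) * triDl (4 * 10 ^ m) ^ 3
      = ∑ i ∈ range (m + 1), triDl (4 * 10 ^ m) ^ 3 := by simp
    _ ≤ ∑ i ∈ range (m + 1), ∑ Q ∈ arcsIn T' L'' (10 ^ i), hexCriticalFugacity ^ mwLen Q :=
        sum_le_sum hblock
    _ = ∑ Q ∈ (range (m + 1)).biUnion (fun i => arcsIn T' L'' (10 ^ i)),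
          hexCriticalFugacity ^ mwLen Q := by
        rw [sum_biUnion]
        intro i _ j _ hij
        exact disjoint_arcsIn T' L'' hij
    _ ≤ stripA T' L'' hexCriticalFugacity := by
        unfold stripA
        apply sum_le_sum_of_subset_of_nonneg
        · intro Q hQ
          rw [mem_biUnion] at hQ
          obtain ⟨i, -, hQ⟩ := hQ
          rw [arcsIn, mem_filter] at hQ
          rw [mem_filter]
          exact ⟨hQ.1, hQ.2.1⟩
        · exact fun _ _ _ => pow_nonneg h0 _
    _ ≤ (Real.cos (3 * Real.pi / 8))⁻¹ :=
        stripA_le_of_lemma2 DuminilCopinSmirnov2012_lemma2_holds (by rw [hT']; omega) L''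

/-- **Glazman–Manolescu, Proposition 1.1 for `D^Δ`: `triDl L → 0`** ("since `D^Δ_T` is
decreasing, this implies `D^Δ_T → 0`"). [cite: GlazmanManolescu2019, Proposition 1.1 (proof, §4.1)] -/
theorem tendsto_triDl : Tendsto triDl atTop (𝓝 0) := by
  rw [Metric.tendsto_atTop]
  intro ε hε
  set c := (Real.cos (3 * Real.pi / 8))⁻¹ with hc
  have hc0 : 0 < c := inv_pos.2 cos_three_pi_div_eight_pos
  obtain ⟨m, hm⟩ := exists_nat_gt (c / ε ^ 3)
  refine ⟨4 * 10 ^ m, fun L hL => ?_⟩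
  rw [Real.dist_eq, sub_zero, abs_of_nonneg (triDl_nonneg L)]
  have h1 : triDl L ≤ triDl (4 * 10 ^ m) := triDl_antitone hL
  have h2 : triDl (4 * 10 ^ m) ^ 3 < ε ^ 3 := by
    have h3 := triDl_pow_three_le m
    have hε3 : 0 < ε ^ 3 := pow_pos hε 3
    have hm' : c < (m + 1 : ℝ) * ε ^ 3 := by
      rw [div_lt_iff₀ hε3] at hm; nlinarith
    by_contra hcon
    push Not at hcon
    have : (m + 1 : ℝ) * ε ^ 3 ≤ (m + 1 : ℝ) * triDl (4 * 10 ^ m) ^ 3 :=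
      mul_le_mul_of_nonneg_left hcon (by positivity)
    linarith
  have h3 : triDl (4 * 10 ^ m) < ε := lt_of_pow_lt_pow_left₀ 3 hε.le h2
  linarith

/-- **`B_{T,L'}(x_c)` is eventually small, uniformly in `L'`**: for every `ε > 0` there is `T₀`
with `B_{T,L'}(x_c) ≤ ε` for all `T ≥ T₀` and all `L'` (Lemma 4.1, eq. (4.1), and `triDl → 0`).
[cite: GlazmanManolescu2019, Proposition 1.1 ("B_T(π/3) → 0")] -/
theorem stripB_eventually_le {ε : ℝ} (hε : 0 < ε) :
    ∃ T₀ : ℕ, ∀ T, T₀ ≤ T → ∀ L' : ℕ, stripB T L' hexCriticalFugacity ≤ ε := by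
  have hc := cos_pi_div_eight_pos
  have hε' : 0 < ε / (2 * Real.cos (Real.pi / 8)) := by positivity
  obtain ⟨L₀, hL₀⟩ := (Metric.tendsto_atTop.1 tendsto_triDl) _ hε'
  refine ⟨2 * L₀ + 1, fun T hT L' => ?_⟩
  have h1 := stripB_le_triDl (L := L₀) (T := T) hT L'
  have h2 := hL₀ L₀ le_rfl
  rw [Real.dist_eq, sub_zero, abs_of_nonneg (triDl_nonneg L₀)] at h2
  calc stripB T L' hexCriticalFugacity ≤ 2 * Real.cos (Real.pi / 8) * triDl L₀ := h1
    _ ≤ 2 * Real.cos (Real.pi / 8) * (ε / (2 * Real.cos (Real.pi / 8))) :=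
        mul_le_mul_of_nonneg_left h2.le (by positivity)
    _ = ε := by field_simp

/-- **Glazman–Manolescu, Proposition 1.1 / [BBDDG, Theorem 10] on the hexagonal lattice:
`B_T(x_c) → 0`**, for Duminil-Copin–Smirnov's bridge partition function
`B_T(x_c) = sup_L B_{T,L}(x_c)` (`HV.stripBlim`) of the strip of `T` rows of hexagons: "the
partition function of self-avoiding bridges on the hexagonal lattice vanishes at infinity".
[cite: GlazmanManolescu2019, Proposition 1.1] -/
theorem tendsto_stripBlim : Tendsto stripBlim atTop (𝓝 0) := by
  rw [Metric.tendsto_atTop]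
  intro ε hε
  obtain ⟨T₀, hT₀⟩ := stripB_eventually_le (half_pos hε)
  refine ⟨T₀, fun T hT => ?_⟩
  have h0 : 0 ≤ stripBlim T :=
    Real.iSup_nonneg fun L => stripB_nonneg hexCriticalFugacity_pos_lt_one.1.le
  have h1 : stripBlim T ≤ ε / 2 := ciSup_le fun L => hT₀ T hT L
  rw [Real.dist_eq, sub_zero, abs_of_nonneg h0]
  linarith

end HV

end Literature.Probability.RandomPlanarGeometry.SAW
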